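import Summits.QuantumFields.BalabanUV.Beta.GAN24.FineReadoutGradient
import Summits.QuantumFields.BalabanUV.Beta.GAN24.FineReadoutCauchyFold

/-!
# `BalabanUV.Beta.GAN24.FineReadoutSecondDiffSymbol` — binder row G-an2-4 / (CONV-C), route of record «QR-LL» (OWNER `gan24-p1` g25/g26, `QR-DESIGN-v0.md`; row (LT)
# «LAYER TRANSPORT», leaf-01's (F) `LayerPushMoments` / (G)), located input (N1″) in the form that exists — PART 1a, THE TWO-STEP DIFFERENCE SYMBOL OF AN ALIAS ON
# THE STRIP: `‖(e^{ik_m·b} − 1)(e^{ik_m·c} − 1)‖ ≤ 4·(X√X)·(√‖b‖₁·‖c‖₁)·e^{(η/N)(‖b‖₁+‖c‖₁)}`, `X = 10·Fsup m/N` (`m ≠ 0`) or `(π+1)/N` (`m = 0`) — the `3/2`-interpolation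

NOT IN PRINT; OUR PROOF ATTEMPT (of the road; THIS file is [folklore] complex analysis + alias bookkeeping: `min(‖x‖,1) ≤ √‖x‖` on one factor, `≤ ‖y‖` on the other,
so two lattice differences cost `‖k̃_m‖^{3/2}`, not `‖k̃_m‖²` — King's exponent `α ∈ {1/2, −1/2}`, both `< 1`; the companion `GAN24/FineReadoutSecondDiff` sums it).
WHY `3/2` AND NOT `2`: two full differences put King's sum AT `α = 1`, which diverges (E3A5 `FineReadoutGradient` header; RESULTS.md (P3)); position side this is the
logarithm of the MIXED second differences of the minimiser column at the codimension-2 faces of the blocks (block-piecewise-constant multiplier right side ⇒ corner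
problem `∂_x∂_y Δ⁻¹χ_quadrant = −(1/2π)·log(1/r) + O(1)`), confirmed on a scalar toy by unit leaf-02 g54 (kit j153041: `N²·max|Δ₁Δ₂φ| = 6.0, 8.5, 10.7, 12.7, 14.6, 15.8` at
`N = 4 … 96`, slope `|λ_alt|/2π` to 1 %; pure second differences bounded — a toy and a continuum computation, NOT a theorem about `wH`; OWNER RULING R-gan24p1-g26-3 withdrew
(N1″) as a target on this evidence) — so the commissioned `k`-uniform pointwise (N1″) at `(L^{d+4})⁻¹` is not available by this method and expected false; the exponent `3/2` is available, and it feeds leaf-01's sockets verbatim (`LayerPushMoments.abs_second_diff_mul_le`'s `ha2`/`hb2`; `abs_tsum_mul_le_of_moments`' `hF` by telescoping) at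
the cost `√L` per transport ((DUH) stays geometric, ratio `Lc^{−1/2}`).
HONEST FRAMING (cell contract, verbatim): «discharging `BetaPertH` makes Bałaban's UV stability UNCONDITIONAL — a real constructive-QFT result; it is NOT the
continuum limit and NOT the Clay problem.»  HONEST DEPENDENCY (verbatim): «continuum YM on T⁴ ⇐ BetaPertH ∧ nine spine estimates (0/9 proved); BetaPertH ⇐ (D1) ∧
(D4) ∧ CAP+tail; G-an2-4 gates asym, D1 and NE2/3/4.»  No cited fact, no wall binder, no `def`, no `def … : Prop`; discharges NOTHING of (LT) ∕ (Q-R) ∕ (Q-L) ∕ (C) ∕ «T2Shape» ∕ (hW, hWall); NEVER «G-an2-4 closed» as (CONV-C); NOT D1, NOT `BetaPertH`,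
NOT continuum, NOT Clay.

## What is proved (generic `d`, `D = d+1`; `|Re p_i| ≤ π`, `|Im p_i| ≤ η`)
* §1 ([folklore] complex analysis) `norm_cexp_sub_one_le_min` (`‖e^x − 1‖ ≤ 2·min(‖x‖,1)·e^{|Re x|}`), `min_one_le_sqrt`, **`norm_cexp_sub_one_mul_le`**
  (`‖(e^x − 1)(e^y − 1)‖ ≤ 4·√‖x‖·‖y‖·e^{|Re x| + |Re y|}`).
* §2 (`2πℤ^D`-shifts of the momentum are invisible on `ℤ^D`: leaf-17's `FineReadoutCauchyFold.pw_add_two_pi_int` BY NAME) THE FOLDED FINE MOMENTUM `k̃_m = (p + 2π·srep m)/N` (no `def`: written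
  out): `kFine_eq_fold_add`, `pw_kFine_eq_pw_fold`, `norm_fold_apply_le`, `norm_fold_le` (`m ≠ 0`, `η ≤ 1/2`: `≤ 10·Fsup m/N`), `norm_fold_zero_le` (`η ≤ 1`:
  `≤ (π+1)/N`), `abs_im_fold_le` (`≤ η/N`); `norm_I_mul_sum_le` ∕ `abs_re_I_mul_sum_le` (the exponent of `pw k b`: norm `≤ ‖k‖·‖b‖₁`, real part `≤ θ·‖b‖₁`);
  **`norm_pw_sub_one_mul_pw_sub_one_le_of_fold`** (generic: `k_m = k + 2πs`, `|Im k| ≤ θ`, `‖k‖ ≤ X` ⇒ `≤ 4·(X√X)·(√‖b‖₁·‖c‖₁)·e^{θ(‖b‖₁+‖c‖₁)}`) and its two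
  instances **`norm_pw_sub_one_mul_pw_sub_one_le`** (`m ≠ 0`, `X = 10F/N`), **`norm_pw_sub_one_mul_pw_sub_one_zero_le`** (`m = 0`, `X = (π+1)/N`).
* §3 `pointWeight_half_eq`, `pointWeight_neg_half_eq` (`√F/F·Πwfold`, `√F/F²·Πwfold` are King's point weights at `α = 1/2`, `−1/2`), `div_mul_sqrt_div`, `mul_mul_sqrt_mul`.
Unit `b2b-balaban-gan24-formalise-leaf-02` (G-an2-4 formalisation swarm, leaf prover 02, gen 54; INTENT I-leaf02-g54-1 «N1-TAYLOR», journal l.40624), 2026-08-22.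
-/

noncomputable section

open Complex Finset Matrix
open scoped BigOperators Real Matrix.Norms.L2Operator
open Literature.Probability.LatticeModels (TorusSite)
open Literature.MathematicalPhysics.QuantumFieldTheory.LatticeForm (repZ)
open Literature.MathematicalPhysics.QuantumFieldTheory.Balaban1983to89
open Literature.MathematicalPhysics.QuantumFieldTheory.Balaban1983to89.Beta
open Literature.MathematicalPhysics.QuantumFieldTheory.King1986 (aliasConst)
open B12Sec2to5 (l1 l1_nonneg)
open B4Strip (reVec)
open AffineAveraging (Site)
open BlochFibreMatrix (Idx stencil pieceMatrix)
open FibreInverseDecay (trigPolySymbol)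
open Summit.QuantumFields.BalabanUV.Beta.GAN24.FibreSymbols (pw)
open Summit.QuantumFields.BalabanUV.Beta.GAN24.FibreBlockSolve (Asol)
open Summit.QuantumFields.BalabanUV.Beta.GAN24.FibreDFT (kFine)
open Summit.QuantumFields.BalabanUV.Beta.GAN24.FibreDFTDictionary (ampA)
open Summit.QuantumFields.BalabanUV.Beta.GAN24.AliasObjects (chiAl sbAl dAl dbAl LAl)
open Summit.QuantumFields.BalabanUV.Beta.GAN24.AliasReindex (srep shiftZ repZ_eq_srep_add)
open Summit.QuantumFields.BalabanUV.Beta.GAN24.ArrowOperator (arrowMat)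
open Summit.QuantumFields.BalabanUV.Beta.GAN24.ArrowScaling (scaledArrow)
open Summit.QuantumFields.BalabanUV.Beta.GAN24.CombesThomasFibre (fibInv)
open Summit.QuantumFields.BalabanUV.Beta.GAN24.AliasPointSum (realVec pointWeight pointWeight_nonneg sum_pointWeight_srep_le)
open Summit.QuantumFields.BalabanUV.Beta.GAN24.FineReadoutAlias (wfold Fsup wfold_nonneg one_le_Fsup lapR_pos half_lapR_le_norm_LAl norm_Asol_border_le)
open Summit.QuantumFields.BalabanUV.Beta.GAN24.FineReadoutApriori (column_apriori)
open Summit.QuantumFields.BalabanUV.Beta.GAN24.FineReadoutSum (norm_pw_repZ_le ampA_eq_Asol)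
open Summit.QuantumFields.BalabanUV.Beta.GAN24.FineReadoutGradient (abs_srep_le_Fsup)
open Summit.QuantumFields.BalabanUV.Beta.GAN24.FineReadoutCauchyFold (pw_add_two_pi_int)

namespace Summit.QuantumFields.BalabanUV.Beta.GAN24.FineReadoutSecondDiffSymbol

/-! ## §1 Two exponentials minus one: the `3/2`-interpolation -/

/-- [folklore] `‖e^x − 1‖ ≤ 2·min(‖x‖, 1)·e^{|Re x|}` (`‖x‖ ≤ 1`: Mathlib's `‖e^x − 1‖ ≤ 2‖x‖`; `‖x‖ > 1`: `‖e^x‖ + 1 = e^{Re x} + 1 ≤ 2e^{|Re x|}`). -/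
theorem norm_cexp_sub_one_le_min (x : ℂ) : ‖cexp x - 1‖ ≤ 2 * min ‖x‖ 1 * Real.exp |x.re| := by
  have hE : 1 ≤ Real.exp |x.re| := Real.one_le_exp (abs_nonneg _)
  by_cases hx : ‖x‖ ≤ 1
  · rw [min_eq_left hx]
    calc ‖cexp x - 1‖ ≤ 2 * ‖x‖ := Complex.norm_exp_sub_one_le hx
      _ = 2 * ‖x‖ * 1 := (mul_one _).symm
      _ ≤ 2 * ‖x‖ * Real.exp |x.re| := mul_le_mul_of_nonneg_left hE (by positivity)
  · rw [min_eq_right (le_of_lt (not_le.1 hx))]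
    calc ‖cexp x - 1‖ ≤ ‖cexp x‖ + ‖(1 : ℂ)‖ := norm_sub_le _ _
      _ = Real.exp x.re + 1 := by rw [Complex.norm_exp, norm_one]
      _ ≤ Real.exp |x.re| + Real.exp |x.re| := add_le_add (Real.exp_le_exp.2 (le_abs_self _)) hE
      _ = 2 * 1 * Real.exp |x.re| := by ring

/-- [folklore] `min(t, 1) ≤ √t` for `t ≥ 0`. -/
theorem min_one_le_sqrt {t : ℝ} (ht : 0 ≤ t) : min t 1 ≤ Real.sqrt t := by
  by_cases h : t ≤ 1
  · rw [min_eq_left h]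
    calc t = Real.sqrt t * Real.sqrt t := (Real.mul_self_sqrt ht).symm
      _ ≤ Real.sqrt t * 1 := mul_le_mul_of_nonneg_left (Real.sqrt_le_one.mpr h) (Real.sqrt_nonneg _)
      _ = Real.sqrt t := mul_one _
  · rw [min_eq_right (le_of_lt (not_le.1 h))]
    exact Real.one_le_sqrt.2 (le_of_lt (not_le.1 h))

/-- [folklore] **THE `3/2`-INTERPOLATION**: `‖(e^x − 1)(e^y − 1)‖ ≤ 4·√‖x‖·‖y‖·e^{|Re x| + |Re y|}` (`min(‖x‖,1) ≤ √‖x‖`, `min(‖y‖,1) ≤ ‖y‖`). -/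
theorem norm_cexp_sub_one_mul_le (x y : ℂ) :
    ‖(cexp x - 1) * (cexp y - 1)‖ ≤ 4 * Real.sqrt ‖x‖ * ‖y‖ * Real.exp (|x.re| + |y.re|) := by
  rw [norm_mul, Real.exp_add]
  have hx := norm_cexp_sub_one_le_min x
  have hy := norm_cexp_sub_one_le_min y
  have h1 : min ‖x‖ 1 ≤ Real.sqrt ‖x‖ := min_one_le_sqrt (norm_nonneg _)
  have h2 : min ‖y‖ 1 ≤ ‖y‖ := min_le_left _ _
  have h0x : 0 ≤ min ‖x‖ 1 := le_min (norm_nonneg _) zero_le_one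
  have h0y : 0 ≤ min ‖y‖ 1 := le_min (norm_nonneg _) zero_le_one
  calc ‖cexp x - 1‖ * ‖cexp y - 1‖ ≤ (2 * min ‖x‖ 1 * Real.exp |x.re|) * (2 * min ‖y‖ 1 * Real.exp |y.re|) :=
        mul_le_mul hx hy (norm_nonneg _) (by positivity)
    _ ≤ (2 * Real.sqrt ‖x‖ * Real.exp |x.re|) * (2 * ‖y‖ * Real.exp |y.re|) := by
        apply mul_le_mul _ _ (by positivity) (by positivity)
        · exact mul_le_mul_of_nonneg_right (mul_le_mul_of_nonneg_left h1 (by norm_num)) (Real.exp_pos _).le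
        · exact mul_le_mul_of_nonneg_right (mul_le_mul_of_nonneg_left h2 (by norm_num)) (Real.exp_pos _).le
    _ = 4 * Real.sqrt ‖x‖ * ‖y‖ * (Real.exp |x.re| * Real.exp |y.re|) := by ring

/-! ## §2 The folded fine momentum and the two-step difference symbol of an alias -/

variable {d N : ℕ} [NeZero N] {p : Fin (d + 1) → ℂ} {η : ℝ}

/-- [folklore] The plane wave unfolds: `pw k b = exp(I·Σ_μ k_μ b_μ)`. -/
theorem pw_eq_cexp (k : Fin (d + 1) → ℂ) (b : Site (d + 1)) : pw k b = cexp (I * ∑ μ, k μ * (b μ : ℂ)) := rfl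

/-- [folklore] THE FOLDED FINE MOMENTUM `k̃_m = (p + 2π·srep m)/N` (symmetric representative `srep m ∈ (−N/2, N/2]^D` instead of the box representative
`repZ m ∈ [0, N)^D`): `k_m = k̃_m + 2π·shiftZ m` coordinatewise. -/
theorem kFine_eq_fold_add (p : Fin (d + 1) → ℂ) (m : TorusSite (d + 1) N) (μ : Fin (d + 1)) :
    kFine p m μ = (p μ + 2 * π * (srep m μ : ℂ)) / (N : ℂ) + 2 * π * (shiftZ m μ : ℂ) := by
  have hN : (N : ℂ) ≠ 0 := Nat.cast_ne_zero.2 (NeZero.ne N)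
  unfold kFine
  rw [repZ_eq_srep_add m μ]
  push_cast
  field_simp
  ring

/-- [folklore] `pw k_m b = pw k̃_m b` for every `b ∈ ℤ^D`. -/
theorem pw_kFine_eq_pw_fold (p : Fin (d + 1) → ℂ) (m : TorusSite (d + 1) N) (b : Site (d + 1)) :
    pw (kFine p m) b = pw (fun μ => (p μ + 2 * π * (srep m μ : ℂ)) / (N : ℂ)) b := by
  rw [← pw_add_two_pi_int (fun μ => (p μ + 2 * π * (srep m μ : ℂ)) / (N : ℂ)) (shiftZ m) b]
  congr 1
  funext μ
  exact kFine_eq_fold_add p m μ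

/-- [folklore] Every coordinate of the folded momentum: `‖k̃_{m,μ}‖ ≤ (|Re p_μ| + |Im p_μ| + 2π·|srep m μ|)/N`. -/
theorem norm_fold_apply_le (p : Fin (d + 1) → ℂ) (m : TorusSite (d + 1) N) (μ : Fin (d + 1)) :
    ‖(p μ + 2 * π * (srep m μ : ℂ)) / (N : ℂ)‖ ≤ (|(p μ).re| + |(p μ).im| + 2 * π * |((srep m μ : ℤ) : ℝ)|) / N := by
  have hN : (0 : ℝ) < N := by exact_mod_cast Nat.pos_of_ne_zero (NeZero.ne N)
  rw [norm_div, Complex.norm_natCast]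
  apply div_le_div_of_nonneg_right _ hN.le
  calc ‖p μ + 2 * π * (srep m μ : ℂ)‖ ≤ ‖p μ‖ + ‖2 * (π : ℂ) * (srep m μ : ℂ)‖ := norm_add_le _ _
    _ ≤ (|(p μ).re| + |(p μ).im|) + 2 * π * |((srep m μ : ℤ) : ℝ)| := by
        apply add_le_add (Complex.norm_le_abs_re_add_abs_im _)
        rw [norm_mul, norm_mul, Complex.norm_ofNat, Complex.norm_real, Real.norm_eq_abs, abs_of_pos Real.pi_pos,
          Complex.norm_intCast]
    _ = _ := by ring

/-- [folklore] **OFF THE ZERO ALIAS** (`Fsup m ≥ 1`; `|Re p_μ| ≤ π`, `|Im p_μ| ≤ η ≤ 1/2`): `‖k̃_m‖ ≤ 10·Fsup m/N`. -/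
theorem norm_fold_le (hre : ∀ i, |(p i).re| ≤ π) (him : ∀ i, |(p i).im| ≤ η) (hη2 : η ≤ 1 / 2) {m : TorusSite (d + 1) N} (hm : m ≠ 0) :
    ‖fun μ => (p μ + 2 * π * (srep m μ : ℂ)) / (N : ℂ)‖ ≤ 10 * Fsup m / N := by
  have hN : (0 : ℝ) < N := by exact_mod_cast Nat.pos_of_ne_zero (NeZero.ne N)
  have hF := one_le_Fsup hm
  refine (pi_norm_le_iff_of_nonneg (by positivity)).2 fun μ => ?_
  refine (norm_fold_apply_le p m μ).trans (div_le_div_of_nonneg_right ?_ hN.le)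
  have h3 := abs_srep_le_Fsup m μ
  have h4 : 0 ≤ (π + 1 / 2) * (Fsup m - 1) := mul_nonneg (by positivity) (sub_nonneg.2 hF)
  nlinarith [hre μ, him μ, Real.pi_lt_d2, Real.pi_pos, mul_le_mul_of_nonneg_left h3 (by positivity : (0:ℝ) ≤ 2 * π)]

/-- [folklore] ON THE ZERO ALIAS (`|Re p_μ| ≤ π`, `|Im p_μ| ≤ η ≤ 1`): `‖k̃_0‖ ≤ (π + 1)/N`. -/
theorem norm_fold_zero_le (hre : ∀ i, |(p i).re| ≤ π) (him : ∀ i, |(p i).im| ≤ η) (hη1 : η ≤ 1) :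
    ‖fun μ => (p μ + 2 * π * (srep (0 : TorusSite (d + 1) N) μ : ℂ)) / (N : ℂ)‖ ≤ (π + 1) / N := by
  have hN : (0 : ℝ) < N := by exact_mod_cast Nat.pos_of_ne_zero (NeZero.ne N)
  refine (pi_norm_le_iff_of_nonneg (by positivity)).2 fun μ => ?_
  refine (norm_fold_apply_le p 0 μ).trans (div_le_div_of_nonneg_right ?_ hN.le)
  have h0 : srep (0 : TorusSite (d + 1) N) μ = 0 := by simp [srep]
  rw [h0]; push_cast; rw [abs_zero, mul_zero, add_zero]
  linarith [hre μ, him μ]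

/-- [folklore] The folded momentum has imaginary part `Im p/N`: `|Im k̃_{m,μ}| ≤ η/N` on the strip. -/
theorem abs_im_fold_le (him : ∀ i, |(p i).im| ≤ η) (m : TorusSite (d + 1) N) (μ : Fin (d + 1)) :
    |((p μ + 2 * π * (srep m μ : ℂ)) / (N : ℂ)).im| ≤ η / N := by
  have hN : (0 : ℝ) < N := by exact_mod_cast Nat.pos_of_ne_zero (NeZero.ne N)
  have h : ((p μ + 2 * π * (srep m μ : ℂ)) / (N : ℂ)).im = (p μ).im / N := by
    rw [Complex.div_natCast_im]
    simp [Complex.add_im]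
  rw [h, abs_div, abs_of_pos hN]
  exact div_le_div_of_nonneg_right (him μ) hN.le

/-- [folklore] The exponent of a plane wave: `‖I·Σ_μ k_μ b_μ‖ ≤ ‖k‖·‖b‖₁`. -/
theorem norm_I_mul_sum_le (k : Fin (d + 1) → ℂ) (b : Site (d + 1)) : ‖I * ∑ μ, k μ * (b μ : ℂ)‖ ≤ ‖k‖ * l1 b := by
  rw [norm_mul, Complex.norm_I, one_mul]
  unfold l1
  rw [Finset.mul_sum]
  refine (norm_sum_le _ _).trans (Finset.sum_le_sum fun μ _ => ?_)
  rw [norm_mul, Complex.norm_intCast]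
  exact mul_le_mul_of_nonneg_right (norm_le_pi_norm k μ) (abs_nonneg _)

/-- [folklore] Its real part: `|Re(I·Σ_μ k_μ b_μ)| ≤ θ·‖b‖₁` when `|Im k_μ| ≤ θ`. -/
theorem abs_re_I_mul_sum_le {k : Fin (d + 1) → ℂ} {θ : ℝ} (hk : ∀ μ, |(k μ).im| ≤ θ) (b : Site (d + 1)) :
    |(I * ∑ μ, k μ * (b μ : ℂ)).re| ≤ θ * l1 b := by
  have hre : (I * ∑ μ, k μ * (b μ : ℂ)).re = -∑ μ, (k μ).im * (b μ : ℝ) := by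
    rw [Complex.I_mul_re, Complex.im_sum]
    congr 1
    refine Finset.sum_congr rfl fun μ _ => ?_
    rw [Complex.mul_im, Complex.intCast_re, Complex.intCast_im, mul_zero, zero_add]
  rw [hre, abs_neg]
  unfold l1
  rw [Finset.mul_sum]
  refine (Finset.abs_sum_le_sum_abs _ _).trans (Finset.sum_le_sum fun μ _ => ?_)
  rw [abs_mul]
  exact mul_le_mul_of_nonneg_right (hk μ) (abs_nonneg _)

omit [NeZero N] in
/-- [folklore] **THE TWO-STEP DIFFERENCE SYMBOL ON THE STRIP, GENERIC MOMENTUM**: if `k_m = k + 2π·s` (`s ∈ ℤ^D`), `|Im k_μ| ≤ θ` and `‖k‖ ≤ X`, then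
`‖(pw k_m b − 1)(pw k_m c − 1)‖ ≤ 4·(X·√X)·(√‖b‖₁·‖c‖₁)·e^{θ(‖b‖₁ + ‖c‖₁)}`. -/
theorem norm_pw_sub_one_mul_pw_sub_one_le_of_fold (m : TorusSite (d + 1) N) {k : Fin (d + 1) → ℂ} {s : Fin (d + 1) → ℤ}
    (hfold : ∀ μ, kFine p m μ = k μ + 2 * π * (s μ : ℂ)) {θ X : ℝ} (hθ : ∀ μ, |(k μ).im| ≤ θ) (hX : ‖k‖ ≤ X) (b c : Site (d + 1)) :
    ‖(pw (kFine p m) b - 1) * (pw (kFine p m) c - 1)‖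
      ≤ 4 * (X * Real.sqrt X) * (Real.sqrt (l1 b) * l1 c) * Real.exp (θ * (l1 b + l1 c)) := by
  have hX0 : 0 ≤ X := (norm_nonneg _).trans hX
  have hb0 := l1_nonneg b
  have hc0 := l1_nonneg c
  have hkm : kFine p m = fun μ => k μ + 2 * π * (s μ : ℂ) := funext hfold
  rw [hkm, pw_add_two_pi_int, pw_add_two_pi_int, pw_eq_cexp, pw_eq_cexp]
  set x : ℂ := I * ∑ μ, k μ * (b μ : ℂ) with hx
  set y : ℂ := I * ∑ μ, k μ * (c μ : ℂ) with hy
  have h := norm_cexp_sub_one_mul_le x y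
  have hxn : ‖x‖ ≤ X * l1 b := (norm_I_mul_sum_le _ _).trans (mul_le_mul_of_nonneg_right hX (l1_nonneg _))
  have hyn : ‖y‖ ≤ X * l1 c := (norm_I_mul_sum_le _ _).trans (mul_le_mul_of_nonneg_right hX (l1_nonneg _))
  have hxr := abs_re_I_mul_sum_le hθ b
  have hyr := abs_re_I_mul_sum_le hθ c
  have hsx : Real.sqrt ‖x‖ ≤ Real.sqrt X * Real.sqrt (l1 b) := by
    rw [← Real.sqrt_mul hX0]; exact Real.sqrt_le_sqrt hxn
  have hexp : Real.exp (|x.re| + |y.re|) ≤ Real.exp (θ * (l1 b + l1 c)) := Real.exp_le_exp.2 (by nlinarith)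
  calc ‖(cexp x - 1) * (cexp y - 1)‖ ≤ 4 * Real.sqrt ‖x‖ * ‖y‖ * Real.exp (|x.re| + |y.re|) := h
    _ ≤ 4 * (Real.sqrt X * Real.sqrt (l1 b)) * (X * l1 c) * Real.exp (θ * (l1 b + l1 c)) := by
        apply mul_le_mul _ hexp (Real.exp_pos _).le (by positivity)
        exact mul_le_mul (mul_le_mul_of_nonneg_left hsx (by norm_num)) hyn (norm_nonneg _) (by positivity)
    _ = 4 * (X * Real.sqrt X) * (Real.sqrt (l1 b) * l1 c) * Real.exp (θ * (l1 b + l1 c)) := by ring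

/-- [folklore] **THE TWO-STEP DIFFERENCE SYMBOL OF A NONZERO ALIAS** (`|Re p_μ| ≤ π`, `|Im p_μ| ≤ η ≤ 1/2`):
`‖(pw k_m b − 1)(pw k_m c − 1)‖ ≤ 4·((10F/N)·√(10F/N))·(√‖b‖₁·‖c‖₁)·e^{(η/N)(‖b‖₁ + ‖c‖₁)}`, `F = Fsup m`. -/
theorem norm_pw_sub_one_mul_pw_sub_one_le (hre : ∀ i, |(p i).re| ≤ π) (him : ∀ i, |(p i).im| ≤ η) (hη2 : η ≤ 1 / 2)
    {m : TorusSite (d + 1) N} (hm : m ≠ 0) (b c : Site (d + 1)) :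
    ‖(pw (kFine p m) b - 1) * (pw (kFine p m) c - 1)‖
      ≤ 4 * (10 * Fsup m / N * Real.sqrt (10 * Fsup m / N)) * (Real.sqrt (l1 b) * l1 c) * Real.exp (η / N * (l1 b + l1 c)) :=
  norm_pw_sub_one_mul_pw_sub_one_le_of_fold m (kFine_eq_fold_add p m) (abs_im_fold_le him m) (norm_fold_le hre him hη2 hm) b c

/-- [folklore] **THE TWO-STEP DIFFERENCE SYMBOL OF THE ZERO ALIAS** (`|Re p_μ| ≤ π`, `|Im p_μ| ≤ η ≤ 1`):
`‖(pw k_0 b − 1)(pw k_0 c − 1)‖ ≤ 4·(((π+1)/N)·√((π+1)/N))·(√‖b‖₁·‖c‖₁)·e^{(η/N)(‖b‖₁ + ‖c‖₁)}`. -/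
theorem norm_pw_sub_one_mul_pw_sub_one_zero_le (hre : ∀ i, |(p i).re| ≤ π) (him : ∀ i, |(p i).im| ≤ η) (hη1 : η ≤ 1) (b c : Site (d + 1)) :
    ‖(pw (kFine p (0 : TorusSite (d + 1) N)) b - 1) * (pw (kFine p (0 : TorusSite (d + 1) N)) c - 1)‖
      ≤ 4 * ((π + 1) / N * Real.sqrt ((π + 1) / N)) * (Real.sqrt (l1 b) * l1 c) * Real.exp (η / N * (l1 b + l1 c)) :=
  norm_pw_sub_one_mul_pw_sub_one_le_of_fold 0 (kFine_eq_fold_add p 0) (abs_im_fold_le him 0) (norm_fold_zero_le hre him hη1) b c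

/-! ## §3 King's point weights at `α = ±1/2` -/

/-- [folklore] `√F/F · Π wfold = pointWeight (1/2) (srep m)` for `m ≠ 0`. -/
theorem pointWeight_half_eq {m : TorusSite (d + 1) N} (hm : m ≠ 0) :
    Real.sqrt (Fsup m) / Fsup m * ∏ i, wfold m i = pointWeight (1 / 2) (srep m) := by
  have hF : 0 < Fsup m := lt_of_lt_of_le one_pos (one_le_Fsup hm)
  have key : Real.sqrt (Fsup m) / Fsup m = Fsup m ^ ((1 : ℝ) / 2 - 1) := by
    rw [show ((1 : ℝ) / 2 - 1) = -(1 / 2 : ℝ) by norm_num, Real.rpow_neg hF.le, ← Real.sqrt_eq_rpow, Real.sqrt_div_self]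
  rw [key]
  unfold pointWeight wfold Fsup realVec
  rfl

/-- [folklore] `√F/F² · Π wfold = pointWeight (−1/2) (srep m)` for `m ≠ 0`. -/
theorem pointWeight_neg_half_eq {m : TorusSite (d + 1) N} (hm : m ≠ 0) :
    Real.sqrt (Fsup m) / Fsup m ^ 2 * ∏ i, wfold m i = pointWeight (-(1 / 2)) (srep m) := by
  have hF : 0 < Fsup m := lt_of_lt_of_le one_pos (one_le_Fsup hm)
  have key : Real.sqrt (Fsup m) / Fsup m ^ 2 = Fsup m ^ (-(1 / 2 : ℝ) - 1) := by
    rw [show (-(1 / 2 : ℝ) - 1) = -(1 + 1 / 2 : ℝ) by norm_num, Real.rpow_neg hF.le, Real.rpow_add hF, Real.rpow_one,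
      ← Real.sqrt_eq_rpow, pow_two, ← div_div, Real.sqrt_div_self, div_eq_mul_inv, ← mul_inv, mul_comm]
  rw [key]
  unfold pointWeight wfold Fsup realVec
  rfl

/-- [folklore] `(a/n)·√(a/n) = (a·√a)/(n·√n)` for `a ≥ 0`, `n > 0`. -/
theorem div_mul_sqrt_div {a n : ℝ} (ha : 0 ≤ a) (hn : 0 < n) : a / n * Real.sqrt (a / n) = a * Real.sqrt a / (n * Real.sqrt n) := by
  rw [Real.sqrt_div ha]
  have hs : Real.sqrt n ≠ 0 := (Real.sqrt_pos.2 hn).ne'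
  field_simp

/-- [folklore] `√(c·a) = √c·√a` repackaged: `(c·a)·√(c·a) = (c·√c)·(a·√a)` for `c, a ≥ 0`. -/
theorem mul_mul_sqrt_mul {c a : ℝ} (hc : 0 ≤ c) (_ha : 0 ≤ a) : c * a * Real.sqrt (c * a) = c * Real.sqrt c * (a * Real.sqrt a) := by
  rw [Real.sqrt_mul hc]; ring

end Summit.QuantumFields.BalabanUV.Beta.GAN24.FineReadoutSecondDiffSymbol

end
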